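import Summits.AnomalousDissipation.AnomalousDissipation.Theorems.SolenoidalFractalHomogenisationRealisedQuasiStaticCellLawOutOfPlaneBlock
import HarnessLib

/-!
# K2R `RealisedQuasiStaticCellLaw`, line `floquet-bloch`: the out-of-plane block of a principal ladder packaged as the
# input of the ladder functional (`ladderFunctional_decay`) (helper towards `stub_lowSectorDecay` / `stub_upperSome`;
# `--supports stmt-AnomalousDissipation-20446`)

Summits-side helper file (everything proved; no definitions, no named facts). Inside a time window `[a, b] ⊆ [0, T]` spent
in slot `j`, the gauged out-of-plane components `v_J = μ_j^{-J} ⟪ζ, α_N(·)(k₀ + J•K_j)⟫` of the Galerkin truncation of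
the cell problem (`…OutOfPlaneBlock.hasDerivWithinAt_gauged_outOfPlane`), restricted to the finite index segment
`Jset = {J | k₀ + J•K_j ∈ freqBall N}` (`exists_cosetIndexSet`), form a curve `V : ℝ → (↥Jset → ℂ)` which is continuous on
`[a, b]` (`continuousOn_outOfPlane_pi`) and solves, at every interior time, the real antisymmetric tridiagonal ladder
`V' = (J ↦ -Λ_j (d_J V_J + g_j(s) ∑_K S_{JK} V_K))` (`hasDerivAt_outOfPlane_pi`) — literally the hypotheses `hcont`,
`hderiv` of `ladderFunctional_decay` (F2, `…LadderFunctionalDecay`), with `Λ_j = κ4π²|K_j|²`,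
`d_J = |k₀ + J•K_j|²/|K_j|²`, `g_j(s) = 2π(ê_j·k₀)|a_j| c_j(s)/Λ_j`, `S_{J,J-1} = 1`, `S_{J,J+1} = -1`. The block energy
`∑_J ‖V_J‖²` is the coefficient energy of the modes `k₀ + J•K_j` along `ζ` (`sum_norm_sq_outOfPlane_pi`).
-/

set_option linter.dupNamespace false

noncomputable section

namespace Summit.AnomalousDissipation.AnomalousDissipation.Theorems.SolenoidalFractalHomogenisation.RealisedQuasiStaticCellLaw

open Set MeasureTheory Filter Topology Function Complex
open scoped InnerProductSpace ComplexConjugate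
open Literature.Analysis Literature.Analysis.FunctionSpaces Literature.Analysis.FunctionSpaces.Torus
open Literature.Analysis.FluidPDE Literature.Analysis.FluidPDE.LatticeShear
open Literature.Analysis.ODE.ThreeTermLadder

variable {k₀ : ℕ}

/-- Translating a base frequency along a non-zero lattice frequency is injective in the integer parameter. -/
theorem coset_injective {K : Fin 3 → ℤ} (hK : K ≠ 0) (k0 : Fin 3 → ℤ) :
    Function.Injective (fun J : ℤ => k0 + J • K) := by
  intro J J' h
  have h1 : J • K = J' • K := add_left_cancel h
  obtain ⟨i, hi⟩ : ∃ i, K i ≠ 0 := by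
    by_contra h0
    push Not at h0
    exact hK (funext h0)
  have h2 := congrFun h1 i
  simp only [Pi.smul_apply, smul_eq_mul] at h2
  exact mul_right_cancel₀ hi h2

/-- **The index segment of a truncated coset**: a finite set of integers `Jset` with `J ∈ Jset ↔ k₀ + J•K ∈ freqBall N`. -/
theorem exists_cosetIndexSet {K : Fin 3 → ℤ} (hK : K ≠ 0) (k0 : Fin 3 → ℤ) (N : ℕ) :
    ∃ Jset : Finset ℤ, ∀ J : ℤ, J ∈ Jset ↔ k0 + J • K ∈ freqBall N := by
  classical
  exact ⟨(freqBall N).preimage (fun J : ℤ => k0 + J • K) (coset_injective hK k0).injOn,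
    fun J => Finset.mem_preimage⟩

/-- **Continuity of the packaged out-of-plane block** on every `[a, b] ⊆ [0, ∞)`. -/
theorem continuousOn_outOfPlane_pi (W : LatticeWord k₀) {n : ℕ} (hn : 0 < n) {κ : ℝ} (hκ : 0 < κ)
    (ℓ : Fin 3 → ℤ) {w₀ : UnitAddTorus (Fin 3) → EuclideanSpace ℝ (Fin 3)}
    (hw₀ : FunctionSpaces.Torus.MemSobolev 1 (FunctionSpaces.EuclideanSpace.complexify ∘ w₀))
    (hdiv : FunctionSpaces.Torus.IsWeaklyDivFree w₀) (hmean : FunctionSpaces.Torus.HasZeroMean w₀)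
    (hsupp : ∀ k : Fin 3 → ℤ, ¬ ((∃ z : Fin 3 → ℤ, k = ℓ + (n:ℤ) • z) ∨ (∃ z : Fin 3 → ℤ, k = -ℓ + (n:ℤ) • z)) →
      UnitAddTorus.mFourierCoeff (FunctionSpaces.EuclideanSpace.complexify ∘ w₀) k = 0)
    (N : ℕ) (j : Fin k₀) (k0 : Fin 3 → ℤ) (ζ : EuclideanSpace ℂ (Fin 3)) (Jset : Finset ℤ) {a b : ℝ} (ha : 0 ≤ a) :
    ContinuousOn (fun s => fun J : ↥Jset =>
      (Complex.I * (Complex.exp ((W.phase j).φ * Complex.I) *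
          (1 / (2 * ((2 * Real.pi * ‖latticeVec (W.phase j).m‖ : ℝ) : ℂ) * Complex.I))) /
          (‖Complex.exp ((W.phase j).φ * Complex.I) *
            (1 / (2 * ((2 * Real.pi * ‖latticeVec (W.phase j).m‖ : ℝ) : ℂ) * Complex.I))‖ : ℂ)) ^ (-(J : ℤ)) *
        inner ℂ ζ ((pvSetup_cell W hn hκ.le ℓ hw₀ hdiv hmean hsupp).galerkinCoeffAt N s
          (k0 + (J : ℤ) • (fun i => (W.phase j).m i * (n : ℤ))))) (Icc a b) := by
  rw [continuousOn_pi]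
  intro J
  refine continuousOn_const.mul (continuousOn_const.inner ?_)
  exact ((pvSetup_cell W hn hκ.le ℓ hw₀ hdiv hmean hsupp).continuousOn_galerkinCoeffAt N _).mono
    fun s hs => (ha.trans hs.1 : (0 : ℝ) ≤ s)

/-- **The packaged out-of-plane block solves the real antisymmetric tridiagonal ladder at interior times** of a window
`[a, b] ⊆ [0, T]` spent in slot `j`: for `s ∈ (a, b)`,
`V' = (J ↦ -Λ_j ((d_J : ℂ) V_J + (g_j(s) : ℂ) ∑_K S_{JK} V_K))` with `Λ_j = κ4π²|K_j|²`, `d_J = |k₀ + J•K_j|²/|K_j|²`,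
`g_j(s) = 2π(ê_j·k₀)|a_j|c_j(s)/Λ_j` and the tridiagonal `S` — the hypothesis `hderiv` of `ladderFunctional_decay`. -/
theorem hasDerivAt_outOfPlane_pi (W : LatticeWord k₀) {n : ℕ} (hn : 0 < n) {κ : ℝ} (hκ : 0 < κ)
    (ℓ : Fin 3 → ℤ) {w₀ : UnitAddTorus (Fin 3) → EuclideanSpace ℝ (Fin 3)}
    (hw₀ : FunctionSpaces.Torus.MemSobolev 1 (FunctionSpaces.EuclideanSpace.complexify ∘ w₀))
    (hdiv : FunctionSpaces.Torus.IsWeaklyDivFree w₀) (hmean : FunctionSpaces.Torus.HasZeroMean w₀)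
    (hsupp : ∀ k : Fin 3 → ℤ, ¬ ((∃ z : Fin 3 → ℤ, k = ℓ + (n:ℤ) • z) ∨ (∃ z : Fin 3 → ℤ, k = -ℓ + (n:ℤ) • z)) →
      UnitAddTorus.mFourierCoeff (FunctionSpaces.EuclideanSpace.complexify ∘ w₀) k = 0)
    {N : ℕ} (hBN : (Finset.univ.biUnion fun j : Fin k₀ =>
        ({(fun i => (W.phase j).m i * n), -(fun i => (W.phase j).m i * n)} : Finset (Fin 3 → ℤ))) ⊆ freqBall N)
    {T a b : ℝ} (ha : 0 ≤ a) (hbT : b ≤ T) (j : Fin k₀)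
    (hwin : ∀ s ∈ Icc a b, Int.fract (s / W.period) * W.period ∈ Icc (W.start j) (W.start j + (W.phase j).τ))
    (k0 : Fin 3 → ℤ) {ζ : EuclideanSpace ℂ (Fin 3)} (hζ₀ : ∑ i, (k0 i : ℂ) * ζ i = 0)
    (hζK : ∑ i, (((fun i => (W.phase j).m i * (n : ℤ)) i : ℤ) : ℂ) * ζ i = 0)
    {Jset : Finset ℤ} (hJset : ∀ J : ℤ, J ∈ Jset ↔ k0 + J • (fun i => (W.phase j).m i * (n : ℤ)) ∈ freqBall N)
    {s : ℝ} (hs : s ∈ Ioo a b) :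
    HasDerivAt (fun τ => fun J : ↥Jset =>
      (Complex.I * (Complex.exp ((W.phase j).φ * Complex.I) *
          (1 / (2 * ((2 * Real.pi * ‖latticeVec (W.phase j).m‖ : ℝ) : ℂ) * Complex.I))) /
          (‖Complex.exp ((W.phase j).φ * Complex.I) *
            (1 / (2 * ((2 * Real.pi * ‖latticeVec (W.phase j).m‖ : ℝ) : ℂ) * Complex.I))‖ : ℂ)) ^ (-(J : ℤ)) *
        inner ℂ ζ ((pvSetup_cell W hn hκ.le ℓ hw₀ hdiv hmean hsupp).galerkinCoeffAt N τ
          (k0 + (J : ℤ) • (fun i => (W.phase j).m i * (n : ℤ)))))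
      (fun J : ↥Jset => -(((κ * (4 * Real.pi ^ 2 * freqNormSq (fun i => (W.phase j).m i * (n : ℤ)))) : ℝ) : ℂ) *
        ((((freqNormSq (k0 + (J : ℤ) • (fun i => (W.phase j).m i * (n : ℤ))) /
              freqNormSq (fun i => (W.phase j).m i * (n : ℤ))) : ℝ) : ℂ) *
            ((Complex.I * (Complex.exp ((W.phase j).φ * Complex.I) *
                (1 / (2 * ((2 * Real.pi * ‖latticeVec (W.phase j).m‖ : ℝ) : ℂ) * Complex.I))) /
                (‖Complex.exp ((W.phase j).φ * Complex.I) *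
                  (1 / (2 * ((2 * Real.pi * ‖latticeVec (W.phase j).m‖ : ℝ) : ℂ) * Complex.I))‖ : ℂ)) ^ (-(J : ℤ)) *
              inner ℂ ζ ((pvSetup_cell W hn hκ.le ℓ hw₀ hdiv hmean hsupp).galerkinCoeffAt N s
                (k0 + (J : ℤ) • (fun i => (W.phase j).m i * (n : ℤ))))) +
          (((2 * Real.pi * (∑ i, (W.phase j).e i * (k0 i : ℝ)) *
                ‖Complex.exp ((W.phase j).φ * Complex.I) *
                  (1 / (2 * ((2 * Real.pi * ‖latticeVec (W.phase j).m‖ : ℝ) : ℂ) * Complex.I))‖ *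
                ((1 / (n : ℝ)) * LatticeWord.trapezoid (W.start j) (W.phase j).τ W.ramp
                  (Int.fract (s / W.period) * W.period)) /
              (κ * (4 * Real.pi ^ 2 * freqNormSq (fun i => (W.phase j).m i * (n : ℤ))))) : ℝ) : ℂ) *
            ∑ K : ↥Jset, ((if (K : ℤ) = (J : ℤ) - 1 then (1 : ℂ) else 0) + (if (K : ℤ) = (J : ℤ) + 1 then -1 else 0)) *
              ((Complex.I * (Complex.exp ((W.phase j).φ * Complex.I) *
                  (1 / (2 * ((2 * Real.pi * ‖latticeVec (W.phase j).m‖ : ℝ) : ℂ) * Complex.I))) /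
                  (‖Complex.exp ((W.phase j).φ * Complex.I) *
                    (1 / (2 * ((2 * Real.pi * ‖latticeVec (W.phase j).m‖ : ℝ) : ℂ) * Complex.I))‖ : ℂ)) ^ (-(K : ℤ)) *
                inner ℂ ζ ((pvSetup_cell W hn hκ.le ℓ hw₀ hdiv hmean hsupp).galerkinCoeffAt N s
                  (k0 + (K : ℤ) • (fun i => (W.phase j).m i * (n : ℤ))))))) s := by
  have hsT : s ∈ Icc 0 T := ⟨ha.trans hs.1.le, hs.2.le.trans hbT⟩
  have hslot := hwin s (Ioo_subset_Icc_self hs)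
  set hPV := pvSetup_cell W hn hκ.le ℓ hw₀ hdiv hmean hsupp with hPVdef
  set K : Fin 3 → ℤ := fun i => (W.phase j).m i * (n : ℤ) with hK
  -- the ℤ-indexed gauged components and their vanishing off the segment
  have hv : ∀ K' : ℤ, K' ∉ Jset →
      (Complex.I * (Complex.exp ((W.phase j).φ * Complex.I) *
          (1 / (2 * ((2 * Real.pi * ‖latticeVec (W.phase j).m‖ : ℝ) : ℂ) * Complex.I))) /
          (‖Complex.exp ((W.phase j).φ * Complex.I) *
            (1 / (2 * ((2 * Real.pi * ‖latticeVec (W.phase j).m‖ : ℝ) : ℂ) * Complex.I))‖ : ℂ)) ^ (-K') *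
        inner ℂ ζ (hPV.galerkinCoeffAt N s (k0 + K' • K)) = 0 := by
    intro K' hK'
    have hnot : k0 + K' • K ∉ freqBall N := fun h => hK' ((hJset K').2 h)
    rw [Torus.PVSetup.galerkinCoeffAt, coeffExt_of_not_mem _ hnot, inner_zero_right, mul_zero]
  have hwithin := hasDerivWithinAt_pi_ladder (s := Icc 0 T) Jset
    (v := fun τ K' => (Complex.I * (Complex.exp ((W.phase j).φ * Complex.I) *
          (1 / (2 * ((2 * Real.pi * ‖latticeVec (W.phase j).m‖ : ℝ) : ℂ) * Complex.I))) /
          (‖Complex.exp ((W.phase j).φ * Complex.I) *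
            (1 / (2 * ((2 * Real.pi * ‖latticeVec (W.phase j).m‖ : ℝ) : ℂ) * Complex.I))‖ : ℂ)) ^ (-K') *
        inner ℂ ζ (hPV.galerkinCoeffAt N τ (k0 + K' • K)))
    (Λ := (((κ * (4 * Real.pi ^ 2 * freqNormSq K)) : ℝ) : ℂ))
    (d := fun J => (((freqNormSq (k0 + J • K) / freqNormSq K) : ℝ) : ℂ))
    (g := (((2 * Real.pi * (∑ i, (W.phase j).e i * (k0 i : ℝ)) *
        ‖Complex.exp ((W.phase j).φ * Complex.I) *
          (1 / (2 * ((2 * Real.pi * ‖latticeVec (W.phase j).m‖ : ℝ) : ℂ) * Complex.I))‖ *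
        ((1 / (n : ℝ)) * LatticeWord.trapezoid (W.start j) (W.phase j).τ W.ramp
          (Int.fract (s / W.period) * W.period)) /
      (κ * (4 * Real.pi ^ 2 * freqNormSq K))) : ℝ) : ℂ)) hv
    (fun J hJ => hasDerivWithinAt_gauged_outOfPlane W hn hκ ℓ hw₀ hdiv hmean hsupp hBN hsT j hslot k0 hζ₀ hζK J
      ((hJset J).1 hJ))
  exact hwithin.hasDerivAt (Icc_mem_nhds (lt_of_le_of_lt ha hs.1) (lt_of_lt_of_le hs.2 hbT))

/-- The energy of the packaged block is the coefficient energy of the modes of the coset along `ζ`: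
`∑_{J : Jset} ‖V_J‖² = ∑_{J ∈ Jset} ‖⟪ζ, α_N(s)(k₀ + J•K_j)⟫‖²` (the gauge is unitary). -/
theorem sum_norm_sq_outOfPlane_pi (W : LatticeWord k₀) {n : ℕ} (hn : 0 < n) {κ : ℝ} (hκ : 0 < κ)
    (ℓ : Fin 3 → ℤ) {w₀ : UnitAddTorus (Fin 3) → EuclideanSpace ℝ (Fin 3)}
    (hw₀ : FunctionSpaces.Torus.MemSobolev 1 (FunctionSpaces.EuclideanSpace.complexify ∘ w₀))
    (hdiv : FunctionSpaces.Torus.IsWeaklyDivFree w₀) (hmean : FunctionSpaces.Torus.HasZeroMean w₀)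
    (hsupp : ∀ k : Fin 3 → ℤ, ¬ ((∃ z : Fin 3 → ℤ, k = ℓ + (n:ℤ) • z) ∨ (∃ z : Fin 3 → ℤ, k = -ℓ + (n:ℤ) • z)) →
      UnitAddTorus.mFourierCoeff (FunctionSpaces.EuclideanSpace.complexify ∘ w₀) k = 0)
    (N : ℕ) (j : Fin k₀) (k0 : Fin 3 → ℤ) (ζ : EuclideanSpace ℂ (Fin 3)) (Jset : Finset ℤ) (s : ℝ) :
    ∑ J : ↥Jset, ‖(Complex.I * (Complex.exp ((W.phase j).φ * Complex.I) *
          (1 / (2 * ((2 * Real.pi * ‖latticeVec (W.phase j).m‖ : ℝ) : ℂ) * Complex.I))) /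
          (‖Complex.exp ((W.phase j).φ * Complex.I) *
            (1 / (2 * ((2 * Real.pi * ‖latticeVec (W.phase j).m‖ : ℝ) : ℂ) * Complex.I))‖ : ℂ)) ^ (-(J : ℤ)) *
        inner ℂ ζ ((pvSetup_cell W hn hκ.le ℓ hw₀ hdiv hmean hsupp).galerkinCoeffAt N s
          (k0 + (J : ℤ) • (fun i => (W.phase j).m i * (n : ℤ))))‖ ^ 2 =
      ∑ J ∈ Jset, ‖inner ℂ ζ ((pvSetup_cell W hn hκ.le ℓ hw₀ hdiv hmean hsupp).galerkinCoeffAt N s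
          (k0 + J • (fun i => (W.phase j).m i * (n : ℤ))))‖ ^ 2 := by
  rw [← Finset.sum_coe_sort Jset]
  refine Finset.sum_congr rfl fun J _ => ?_
  rw [norm_gauge_zpow_mul (layerAmp_ne_zero (W.phase j))]

end Summit.AnomalousDissipation.AnomalousDissipation.Theorems.SolenoidalFractalHomogenisation.RealisedQuasiStaticCellLaw

end
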